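import Summits.QuantumAdvantage.QuantumAdvantage.Theorems.CubicForrelationNearExactIsExactTwelveLevelFiveOffFlatB

/-!
# Crux `CubicForrelation.NearExactIsExact` (stmt-QuantumAdvantage-14043) — n = 12, INSIDE the open window: a level-5 side with `Φ ≥ 953/1024` is
  exact (one-sided, no exceptional value)

Certificate seat `b2b-cforr-cert` (gen 13).  HONEST FRAMING: a kernel-checked THEOREM (standard axioms) about cubic Boolean pairs on 12 bits,
strictly inside the open window; the level-5 branch of "`Φ ≥ 953/1024 ⇒ Φ = 1` on 12 bits" (`…TwelveWindow953.lean`).  NOT summit progress.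

THEOREM `tw5_levelFive_window_all`: cubic `f, g : 𝔽₂¹² → 𝔽₂`, `W_g = 32·u'` with some `u'(x)` odd, `Φ(f,g) ≥ 953/1024` ⇒ `Φ(f,g) = 1`.
It supersedes `tw5_levelFive_window` (bound `955/1024`, which also needed the partner's spectrum in `32ℤ`): the ENGINE ending is one-sided.

Proof: as in `tw5_levelFive_window` (`P = {u' odd}` hyperplane `x_P ⊕ V`, `B = Σ(u' − 2s)² = 2¹⁵(1 − Φ) ≤ 2272`, `e = u' − 2s = 0` off `P`
by `tw5_off_flat_lt`, cubic digit `tw5_digit`, `e = σ + 8m` on `P` with `σ = −(−1)^D` after the 7-flat parity round).  New ending: one direction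
`t ∉ V` localises the 4- and 5-flat sums of `u − 4s = 2e` (`fr_sum_peel`): (H3)/(H4) hold for `e` on `P`, hence for `σ = e − 8m`; the engine
`fl1_flat_l1` gives `Σ_y |W_{σ·1_P}(y)| ≤ 2¹³`, `fl1_pairing` turns it into `Σ_P σu' ≤ 256`; but `4Σ_x u's = 32768 − B`, `u's = 2` off `P`,
`σu' = 2u's − 3 + 8m(σ − 2s)` and `16m(σ − 2s) + (e² − 1) ≥ 0` (`tw5_pt_ineq`) give `Σ_P σu' ≥ 7056 − 6144 − 112 = 800` — contradiction.
Below `953/1024` odd-`ω` 6-flats and off-flat points become affordable; nothing here is uniform in `n`.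

References: Ax (1964) / McEliece (1972); MacWilliams–Sloane (1977) Ch. 13–15; Carlet (2021) §2–4; O'Donnell (2014) §3.3.
-/

set_option linter.dupNamespace false -- D-0017: single-problem summit ⇒ `QuantumAdvantage.QuantumAdvantage` by design

noncomputable section

namespace Summit.QuantumAdvantage.QuantumAdvantage.Theorems.CubicForrelation.NearExactIsExact

open Finset
open Literature.Computability.QuantumComplexity
open Literature.Computability.QuantumComplexity.BuzetChailloux (bxor zeroVec bxor_bxor_cancel_left bxor_zeroVec zeroVec_bxor bxor_comm
  bxor_self twist_zeroVec_right)
open Literature.Computability.QuantumComplexity.DerivativeWalsh (W)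

/-! ### A pointwise inequality -/

/-- For `σ, s = ±1` and an integer `m`: `16·m(σ − 2s) + ((σ + 8m)² − 1) ≥ 0`. [this work] -/
theorem tw5_pt_ineq (σ s m : ℤ) (hσ : σ = 1 ∨ σ = -1) (hs : s = 1 ∨ s = -1) :
    0 ≤ 2 * (8 * (m * (σ - 2 * s))) + ((σ + 8 * m) ^ 2 - 1) := by
  have key : 2 * (8 * (m * (σ - 2 * s))) + ((σ + 8 * m) ^ 2 - 1) = 32 * m * (2 * m + σ - s) + (σ ^ 2 - 1) := by ring
  have hσ2 : σ ^ 2 = 1 := by rcases hσ with rfl | rfl <;> norm_num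
  rw [key, hσ2, sub_self, add_zero]
  rcases lt_trichotomy m 0 with hm | rfl | hm
  · have h2 : 2 * m + σ - s ≤ 0 := by rcases hσ with rfl | rfl <;> rcases hs with rfl | rfl <;> omega
    nlinarith [mul_nonneg (show (0 : ℤ) ≤ -m by omega) (show (0 : ℤ) ≤ -(2 * m + σ - s) by omega)]
  · norm_num
  · have h2 : 0 ≤ 2 * m + σ - s := by rcases hσ with rfl | rfl <;> rcases hs with rfl | rfl <;> omega
    nlinarith [mul_nonneg (show (0 : ℤ) ≤ m by omega) h2]

/-! ### The theorem -/

/-- **Level 5 on 12 bits: `Φ ≥ 953/1024 ⇒ Φ = 1`** (one-sided).  For cubic `f, g : 𝔽₂¹² → 𝔽₂` with `W_g = 32·u'`, some `u'(x)` odd and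
`Φ(f,g) ≥ 953/1024`, the pair is exact.  Finite-slice statement; NOT summit progress. [this work] -/
theorem tw5_levelFive_window_all (f g : (Fin (6 + 6) → Bool) → Bool) (hf : IsDegLeFun 3 f) (hg : IsDegLeFun 3 g)
    (u' : (Fin (6 + 6) → Bool) → ℤ) (hu' : ∀ x, W (fun y => signOf (g y)) x = (2 : ℝ) ^ 5 * (u' x : ℝ))
    (hodd : ∃ x, Odd (u' x)) (hΦ : (953 / 1024 : ℝ) ≤ forrelation f g) : forrelation f g = 1 := by
  classical
  by_cases h1516 : (15 / 16 : ℝ) ≤ forrelation f g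
  · exact tw12_isolation_ge f g hf hg h1516
  exfalso
  push Not at h1516
  -- `u = 2u'` at the Ax level `4`; residual `e = u' − 2s`, budget `B = Σ e² = 2¹⁵(1 − Φ) ∈ (2048, 2208]`
  set u : (Fin (6 + 6) → Bool) → ℤ := fun x => 2 * u' x with hudef
  have hu : ∀ x, W (fun y => signOf (g y)) x = (2 : ℝ) ^ 4 * (u x : ℝ) := by
    intro x; rw [hu' x]; simp only [u]; push_cast; ring
  set e : (Fin (6 + 6) → Bool) → ℤ := fun x => u' x - 2 * sZ (f x) with hedef
  have hbud := tw12_budget f g u hu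
  have h4e : ∀ x, (u x - 4 * sZ (f x)) ^ 2 = 4 * e x ^ 2 := fun x => by simp only [u, e]; ring
  have hBR : ((∑ x, e x ^ 2 : ℤ) : ℝ) = 32768 * (1 - forrelation f g) := by
    have h' : ((∑ x, (u x - 4 * sZ (f x)) ^ 2 : ℤ) : ℝ) = 4 * ((∑ x, e x ^ 2 : ℤ) : ℝ) := by
      rw [sum_congr rfl fun x _ => h4e x, ← mul_sum]; push_cast; ring
    rw [h'] at hbud
    linarith
  have hB_le : (∑ x, e x ^ 2 : ℤ) ≤ 2272 := by
    have h' : ((∑ x, e x ^ 2 : ℤ) : ℝ) ≤ 2272 := by rw [hBR]; linarith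
    exact_mod_cast h'
  have hB_gt : 2048 < (∑ x, e x ^ 2 : ℤ) := by
    have h' : (2048 : ℝ) < ((∑ x, e x ^ 2 : ℤ) : ℝ) := by rw [hBR]; linarith
    exact_mod_cast h'
  -- the odd set `P` of `u'` is an affine hyperplane
  have hℓ : IsDegLeFun 1 (fun x => decide (Odd (u' x))) :=
    stub_walshTower stub_axParity (6 + 6) 5 1 g u' hg hu' (by intro k hk hkn; omega)
  set P := univ.filter (fun x : Fin (6 + 6) → Bool => Odd (u' x)) with hPdef
  have hmemP : ∀ x, x ∈ P ↔ Odd (u' x) := fun x => by simp [hPdef]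
  have heodd : ∀ x, x ∈ P → Odd (e x) := by
    intro x hx
    exact Int.odd_sub.2 (iff_of_true ((hmemP x).1 hx) ⟨sZ (f x), two_mul _⟩)
  have hsq1 : ∀ x, x ∈ P → 1 ≤ e x ^ 2 := by
    intro x hx
    have h0 := Int.odd_iff.1 (heodd x hx)
    have : e x ≤ -1 ∨ 1 ≤ e x := by omega
    have := tp_sq_ge (k := 1) (by norm_num) this
    linarith
  have hsplit : (∑ x, e x ^ 2 : ℤ) = ∑ x ∈ P, e x ^ 2 + ∑ x ∈ univ.filter (fun x => x ∉ P), e x ^ 2 := by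
    rw [← sum_filter_add_sum_filter_not univ (fun x => x ∈ P)]
    congr 1
    exact sum_congr (by ext x; simp) fun _ _ => rfl
  have hoff_nn : 0 ≤ ∑ x ∈ univ.filter (fun x => x ∉ P), e x ^ 2 := sum_nonneg fun x _ => sq_nonneg _
  have hPle : (#P : ℤ) ≤ 2272 := by
    have h1 : (#P : ℤ) = ∑ x ∈ P, (1 : ℤ) := by rw [sum_const, nsmul_eq_mul, mul_one]
    have h2 : ∑ x ∈ P, (1 : ℤ) ≤ ∑ x ∈ P, e x ^ 2 := sum_le_sum fun x hx => hsq1 x hx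
    linarith
  have hfilt : (univ.filter fun x : Fin (6 + 6) → Bool => decide (Odd (u' x)) = true) = P := filter_congr fun x _ => by simp
  have hPge : 2048 ≤ #P := by
    obtain ⟨x₁, hx₁⟩ := hodd
    have hRM := bb_rmWeight_holds (6 + 6) 1 (fun x => decide (Odd (u' x))) hℓ ⟨x₁, decide_eq_true hx₁⟩
    rw [hfilt] at hRM
    norm_num at hRM
    omega
  have hPc : 2048 ≤ #(univ.filter fun x : Fin (6 + 6) → Bool => x ∉ P) := by
    have hPlt : #P < 4096 := by
      have hlt' : (#P : ℤ) < 4096 := by linarith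
      exact_mod_cast hlt'
    have hne : ∃ x, x ∉ P := by
      by_contra hall
      push Not at hall
      have : #P = 4096 := by
        rw [show P = univ from eq_univ_of_forall hall, card_univ, Fintype.card_fun, Fintype.card_bool, Fintype.card_fin]; norm_num
      omega
    obtain ⟨x₂, hx₂⟩ := hne
    have hℓ' : IsDegLeFun 1 (fun x => decide (Odd (u' x)) ^^ true) := tb_isDegLeFun_xor_const hℓ true
    have hRM := bb_rmWeight_holds (6 + 6) 1 (fun x => decide (Odd (u' x)) ^^ true) hℓ'
      ⟨x₂, by have := (hmemP x₂).not.1 hx₂; simpa using this⟩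
    have hfilt' : (univ.filter fun x : Fin (6 + 6) → Bool => (decide (Odd (u' x)) ^^ true) = true) =
        univ.filter fun x : Fin (6 + 6) → Bool => x ∉ P := filter_congr fun x _ => by rw [hmemP]; simp
    rw [hfilt'] at hRM
    norm_num at hRM ⊢
    omega
  have hcardP : #P = 2048 := by
    have htot : #P + #(univ.filter fun x : Fin (6 + 6) → Bool => x ∉ P) = 4096 := by
      have h := Finset.card_filter_add_card_filter_not (s := (univ : Finset (Fin (6 + 6) → Bool))) (fun x => x ∈ P)
      rw [card_univ, Fintype.card_fun, Fintype.card_bool, Fintype.card_fin] at h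
      have e1 : (univ.filter fun x : Fin (6 + 6) → Bool => x ∈ P) = P := by ext x; simp
      rw [e1] at h
      norm_num at h
      exact h
    omega
  -- `P` is a coset of an xor-closed `V` with `2¹¹` elements
  have hmw := mw_flat_of_minweight 0 (fun x => decide (Odd (u' x))) hℓ (by rw [hfilt, hcardP]; norm_num)
  rw [hfilt] at hmw
  obtain ⟨h0, hadd, hcardV, hcoset⟩ := hmw
  set V := univ.filter (fun a : Fin (6 + 6) → Bool => ∀ x, decide (Odd (u' (bxor x a))) = decide (Odd (u' x))) with hV
  obtain ⟨xP, hxP⟩ : P.Nonempty := card_pos.1 (by rw [hcardP]; norm_num)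
  have hS : P = V.image (bxor xP) := hcoset xP (decide_eq_true ((hmemP xP).1 hxP))
  rw [hcardP] at hcardV
  have hcardV11 : #V = 2 ^ 11 := by rw [hcardV]; norm_num
  have hPV : ∀ x, x ∈ P → ∀ a ∈ V, bxor x a ∈ P := fun x hx a ha => fl1_coset_vadd hadd hS hx ha
  -- budget split
  have hPsum_ge : (2048 : ℤ) ≤ ∑ x ∈ P, e x ^ 2 := by
    have h1 : ∑ x ∈ P, (1 : ℤ) ≤ ∑ x ∈ P, e x ^ 2 := sum_le_sum fun x hx => hsq1 x hx
    rw [sum_const, nsmul_eq_mul, mul_one, hcardP] at h1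
    exact_mod_cast h1
  have hoff_lt : ∑ x ∈ univ.filter (fun x => x ∉ P), e x ^ 2 < 256 := by linarith
  have hon_le : ∑ x ∈ P, (e x ^ 2 - 1) ≤ 224 := by
    rw [sum_sub_distrib, sum_const, nsmul_eq_mul, mul_one, hcardP]; push_cast; linarith
  -- the residual vanishes off `P`
  have hoff0 : ∀ y, y ∉ P → e y = 0 := tw5_off_flat_lt f g hf hg u' hu' V xP h0 hadd hcardV11 hS hoff_lt
  have hoff0sum : ∑ x ∈ univ.filter (fun x => x ∉ P), e x ^ 2 = 0 :=
    sum_eq_zero fun x hx => by rw [hoff0 x (mem_filter.1 hx).2]; norm_num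
  -- the digit `D`, the sign `σ = −(−1)^D ≡ e (mod 4)` on `P`, and the wild part `ω`
  have hD : IsDegLeFun 3 (fun x => decide (Odd (u' x / 2))) := tw5_digit g hg u' hu' hℓ
  set σ : (Fin (6 + 6) → Bool) → ℤ := fun x => - sZ (decide (Odd (u' x / 2))) with hσ
  set ω : (Fin (6 + 6) → Bool) → ℤ := fun x => (e x - σ x) / 4 with hω
  have hσval : ∀ x, σ x = 1 ∨ σ x = -1 := by
    intro x; simp only [σ]; rcases tp_sZ_cases (decide (Odd (u' x / 2))) with h | h <;> rw [h] <;> norm_num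
  have hdec : ∀ x, x ∈ P → e x = σ x + 4 * ω x := by
    intro x hx
    have h1 := Int.odd_iff.1 ((hmemP x).1 hx)
    have h4 : (4 : ℤ) ∣ e x - σ x := by
      simp only [e, σ]
      rcases tp_sZ_cases (f x) with hs | hs <;> rw [hs]
      · by_cases hq : Odd (u' x / 2)
        · have hq' := Int.odd_iff.1 hq
          simp only [hq, decide_true, sZ, if_true]; omega
        · have hq' : u' x / 2 % 2 = 0 := Int.even_iff.1 (Int.not_odd_iff_even.1 hq)
          simp only [hq, decide_false, sZ, Bool.false_eq_true, if_false]; omega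
      · by_cases hq : Odd (u' x / 2)
        · have hq' := Int.odd_iff.1 hq
          simp only [hq, decide_true, sZ, if_true]; omega
        · have hq' : u' x / 2 % 2 = 0 := Int.even_iff.1 (Int.not_odd_iff_even.1 hq)
          simp only [hq, decide_false, sZ, Bool.false_eq_true, if_false]; omega
    have := Int.mul_ediv_cancel' h4
    simp only [ω]
    linarith
  -- 7-flat sums inside `P`: `16 ∣ Σ e`, `8 ∣ Σ σ`, hence `Σ ω` is even
  have hflat7 : ∀ (b : Fin (6 + 6) → Bool) (a : Fin 7 → Fin (6 + 6) → Bool),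
      (16 : ℤ) ∣ ∑ ε : Fin 7 → Bool, e (fun j => b j ^^ decide (Odd #(univ.filter fun i => ε i && a i j))) := by
    intro b a
    have h1 := fs_flat_sum_dvd (e := 5) g u hg hu b a (by norm_num)
    obtain ⟨zf, hzf⟩ := sl_sum_sZ_flat f hf b a
    have hzf' : ∑ ε : Fin 7 → Bool, 2 * sZ (f (fun j => b j ^^ decide (Odd #(univ.filter fun i => ε i && a i j)))) = 16 * zf := by
      rw [← mul_sum, hzf]; norm_num; ring
    have h1' : 2 * 16 ∣ 2 * ∑ ε : Fin 7 → Bool, u' (fun j => b j ^^ decide (Odd #(univ.filter fun i => ε i && a i j))) := by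
      rw [mul_sum]; norm_num at h1 ⊢; exact h1
    have h1'' := (mul_dvd_mul_iff_left (two_ne_zero (α := ℤ))).1 h1'
    have h3 : ∑ ε : Fin 7 → Bool, e (fun j => b j ^^ decide (Odd #(univ.filter fun i => ε i && a i j))) =
        ∑ ε : Fin 7 → Bool, u' (fun j => b j ^^ decide (Odd #(univ.filter fun i => ε i && a i j))) -
        ∑ ε : Fin 7 → Bool, 2 * sZ (f (fun j => b j ^^ decide (Odd #(univ.filter fun i => ε i && a i j)))) := by
      rw [← sum_sub_distrib]
    rw [h3, hzf']
    exact dvd_sub h1'' (Dvd.intro _ rfl)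
  have hωeven : ∀ x, x ∈ P → Even (ω x) := by
    rcases ws_erm_round V h0 hadd hcardV11 xP ω 6 (fun b hb a ha => by
        rw [← hS] at hb
        have hpts : ∀ ε : Fin (6 + 1) → Bool, (fun j => b j ^^ decide (Odd #(univ.filter fun i => ε i && a i j))) ∈ P :=
          fun ε => ws_flatPt_mem V h0 (· ∈ P) hPV (6 + 1) b hb a ha ε
        have h16 := hflat7 b a
        obtain ⟨zσ, hzσ⟩ := sl_sum_sZ_flat (fun x => decide (Odd (u' x / 2))) hD b a
        have hσsum : ∑ ε : Fin (6 + 1) → Bool, σ (fun j => b j ^^ decide (Odd #(univ.filter fun i => ε i && a i j))) = - (8 * zσ) := by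
          simp only [σ]; rw [sum_neg_distrib, hzσ]; norm_num
        rw [sum_congr rfl fun ε _ => hdec _ (hpts ε), sum_add_distrib, ← mul_sum, hσsum] at h16
        obtain ⟨k, hk⟩ := h16
        exact ⟨2 * k + zσ, by linarith⟩) with hev | hbig
    · intro x hx; exact hev x (by rwa [← hS])
    · exfalso
      rw [← hS] at hbig
      -- `≥ 32` points of `P` with `ω` odd, each costing `e² − 1 ≥ 8`
      have hcost : ∀ x ∈ P.filter (fun x => Odd (ω x)), (8 : ℤ) ≤ e x ^ 2 - 1 := by
        intro x hx
        have hxP := (mem_filter.1 hx).1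
        have ho := Int.odd_iff.1 (mem_filter.1 hx).2
        have hd := hdec x hxP
        rcases hσval x with hs | hs <;> rw [hs] at hd
        · have : e x ≤ -3 ∨ 3 ≤ e x := by omega
          have := tp_sq_ge (k := 3) (by norm_num) this; linarith
        · have : e x ≤ -3 ∨ 3 ≤ e x := by omega
          have := tp_sq_ge (k := 3) (by norm_num) this; linarith
      have h1 : ∑ x ∈ P.filter (fun x => Odd (ω x)), (8 : ℤ) ≤ ∑ x ∈ P.filter (fun x => Odd (ω x)), (e x ^ 2 - 1) := sum_le_sum hcost
      have h2 : ∑ x ∈ P.filter (fun x => Odd (ω x)), (e x ^ 2 - 1) ≤ ∑ x ∈ P, (e x ^ 2 - 1) :=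
        sum_le_sum_of_subset_of_nonneg (filter_subset _ _) (fun x hx _ => by have := hsq1 x hx; linarith)
      rw [sum_const, nsmul_eq_mul] at h1
      norm_num at hbig
      have : (32 : ℤ) ≤ #(P.filter (fun x => Odd (ω x))) := by exact_mod_cast (by omega)
      linarith
  -- `m = ω/2`; the wild set `Wd = {m ≠ 0}` has `≤ 3` points, `|m| = 1` there
  set m : (Fin (6 + 6) → Bool) → ℤ := fun x => ω x / 2 with hm
  have hdec2 : ∀ x, x ∈ P → e x = σ x + 8 * m x := by
    intro x hx
    have h := hdec x hx
    have hmm : ω x = 2 * m x := (Int.mul_ediv_cancel' (even_iff_two_dvd.1 (hωeven x hx))).symm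
    rw [h, hmm]; ring
  -- ONE transversal direction localises the 4- and 5-flat sums: (H3)/(H4) for `e`, hence for `σ` (since `e = σ + 8m` on `P`)
  have hNcard : #(univ : Finset (Fin (6 + 6) → Bool)) = 4096 := by
    rw [card_univ, Fintype.card_fun, Fintype.card_bool, Fintype.card_fin]; norm_num
  obtain ⟨t, -, ht⟩ := fl1_avoid univ V [zeroVec] (by rw [List.length_singleton, hcardV11, hNcard]; norm_num)
  have htV : t ∉ V := by simpa only [zeroVec_bxor] using ht zeroVec (by simp)
  have hF0 : ∀ y, y ∉ P → u y - 4 * sZ (f y) = 0 := by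
    intro y hy; have h := hoff0 y hy; simp only [e] at h; simp only [u]; linarith
  have hFe : ∀ y, u y - 4 * sZ (f y) = 2 * e y := fun y => by simp only [u, e]; ring
  have hloc : ∀ {kk : ℕ} (x : Fin (6 + 6) → Bool) (a : Fin kk → Fin (6 + 6) → Bool),
      (∀ ε : Fin kk → Bool, (fun j => x j ^^ decide (Odd #(univ.filter fun i => ε i && a i j))) ∈ P) →
      ∑ ε : Fin (kk + 1) → Bool, (u (fun j => x j ^^ decide (Odd #(univ.filter fun i =>
          ε i && (Matrix.vecCons t a : Fin (kk + 1) → Fin (6 + 6) → Bool) i j))) -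
        4 * sZ (f (fun j => x j ^^ decide (Odd #(univ.filter fun i =>
          ε i && (Matrix.vecCons t a : Fin (kk + 1) → Fin (6 + 6) → Bool) i j))))) =
      ∑ ε : Fin kk → Bool, 2 * e (fun j => x j ^^ decide (Odd #(univ.filter fun i => ε i && a i j))) := by
    intro kk x a hin
    have p1 := fr_sum_peel (fun y => u y - 4 * sZ (f y)) x t a
    beta_reduce at p1
    rw [p1, sum_eq_zero fun ε _ => hF0 _ (fl1_coset_out h0 hadd hS (hin ε) htV), add_zero]
    exact sum_congr rfl fun ε _ => hFe _
  have H3σ : ∀ x ∈ P, ∀ a b c : Fin (6 + 6) → Bool, a ∈ V → b ∈ V → c ∈ V →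
      (4 : ℤ) ∣ ∑ ε : Fin 3 → Bool, σ (fun j => x j ^^ decide (Odd #(univ.filter fun i =>
        ε i && (![a, b, c] : Fin 3 → Fin (6 + 6) → Bool) i j))) := by
    intro x hx a b c ha hb hc
    have hin : ∀ ε : Fin 3 → Bool, (fun j => x j ^^ decide (Odd #(univ.filter fun i =>
        ε i && (![a, b, c] : Fin 3 → Fin (6 + 6) → Bool) i j))) ∈ P :=
      fun ε => fr_mem_flatPt3 V h0 (· ∈ P) hPV hx ![a, b, c] (fun i => by fin_cases i <;> assumption) ε
    have h8 := fs_flat_sum_dvd (e := 3) g u hg hu x ![t, a, b, c] (by norm_num)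
    obtain ⟨zf, hzf⟩ := sl_sum_sZ_flat f hf x ![t, a, b, c]
    have hzf' : ∑ ε : Fin 4 → Bool, 4 * sZ (f (fun j => x j ^^ decide (Odd #(univ.filter fun i =>
          ε i && (![t, a, b, c] : Fin 4 → Fin (6 + 6) → Bool) i j)))) = 8 * (2 * zf) := by
      rw [← mul_sum, hzf]; norm_num; ring
    have h8n : (8 : ℤ) ∣ ∑ ε : Fin 4 → Bool, u (fun j => x j ^^ decide (Odd #(univ.filter fun i =>
          ε i && (![t, a, b, c] : Fin 4 → Fin (6 + 6) → Bool) i j))) := by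
      have e8 : (2 : ℤ) ^ 3 = 8 := by norm_num
      rw [e8] at h8; exact h8
    have h8' : (8 : ℤ) ∣ ∑ ε : Fin 4 → Bool, (u (fun j => x j ^^ decide (Odd #(univ.filter fun i =>
          ε i && (![t, a, b, c] : Fin 4 → Fin (6 + 6) → Bool) i j))) -
        4 * sZ (f (fun j => x j ^^ decide (Odd #(univ.filter fun i =>
          ε i && (![t, a, b, c] : Fin 4 → Fin (6 + 6) → Bool) i j))))) := by
      rw [sum_sub_distrib, hzf']
      exact dvd_sub h8n (Dvd.intro _ rfl)
    rw [hloc x ![a, b, c] hin, ← mul_sum, sum_congr rfl fun ε _ => hdec2 _ (hin ε), sum_add_distrib, ← mul_sum] at h8'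
    obtain ⟨k8, hk8⟩ := h8'
    exact ⟨k8 - 2 * ∑ ε : Fin 3 → Bool, m (fun j => x j ^^ decide (Odd #(univ.filter fun i =>
        ε i && (![a, b, c] : Fin 3 → Fin (6 + 6) → Bool) i j))), by linarith⟩
  have H4σ : ∀ x ∈ P, ∀ a₀ a₁ a₂ a₃ : Fin (6 + 6) → Bool, a₀ ∈ V → a₁ ∈ V → a₂ ∈ V → a₃ ∈ V →
      (8 : ℤ) ∣ ∑ ε : Fin 4 → Bool, σ (fun j => x j ^^ decide (Odd #(univ.filter fun i =>
        ε i && (![a₀, a₁, a₂, a₃] : Fin 4 → Fin (6 + 6) → Bool) i j))) := by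
    intro x hx a₀ a₁ a₂ a₃ ha₀ ha₁ ha₂ ha₃
    have hin : ∀ ε : Fin 4 → Bool, (fun j => x j ^^ decide (Odd #(univ.filter fun i =>
        ε i && (![a₀, a₁, a₂, a₃] : Fin 4 → Fin (6 + 6) → Bool) i j))) ∈ P :=
      fun ε => fr_mem_flatPt4 V h0 (· ∈ P) hPV hx ![a₀, a₁, a₂, a₃] (fun i => by fin_cases i <;> assumption) ε
    have h16 := fs_flat_sum_dvd (e := 4) g u hg hu x ![t, a₀, a₁, a₂, a₃] (by norm_num)
    obtain ⟨zf, hzf⟩ := sl_sum_sZ_flat f hf x ![t, a₀, a₁, a₂, a₃]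
    have hzf' : ∑ ε : Fin 5 → Bool, 4 * sZ (f (fun j => x j ^^ decide (Odd #(univ.filter fun i =>
          ε i && (![t, a₀, a₁, a₂, a₃] : Fin 5 → Fin (6 + 6) → Bool) i j)))) = 16 * zf := by
      rw [← mul_sum, hzf]; norm_num; ring
    have h16n : (16 : ℤ) ∣ ∑ ε : Fin 5 → Bool, u (fun j => x j ^^ decide (Odd #(univ.filter fun i =>
          ε i && (![t, a₀, a₁, a₂, a₃] : Fin 5 → Fin (6 + 6) → Bool) i j))) := by
      have e16 : (2 : ℤ) ^ 4 = 16 := by norm_num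
      rw [e16] at h16; exact h16
    have h16' : (16 : ℤ) ∣ ∑ ε : Fin 5 → Bool, (u (fun j => x j ^^ decide (Odd #(univ.filter fun i =>
          ε i && (![t, a₀, a₁, a₂, a₃] : Fin 5 → Fin (6 + 6) → Bool) i j))) -
        4 * sZ (f (fun j => x j ^^ decide (Odd #(univ.filter fun i =>
          ε i && (![t, a₀, a₁, a₂, a₃] : Fin 5 → Fin (6 + 6) → Bool) i j))))) := by
      rw [sum_sub_distrib, hzf']
      exact dvd_sub h16n (Dvd.intro _ rfl)
    rw [hloc x ![a₀, a₁, a₂, a₃] hin, ← mul_sum, sum_congr rfl fun ε _ => hdec2 _ (hin ε), sum_add_distrib, ← mul_sum] at h16'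
    obtain ⟨k16, hk16⟩ := h16'
    exact ⟨k16 - ∑ ε : Fin 4 → Bool, m (fun j => x j ^^ decide (Odd #(univ.filter fun i =>
        ε i && (![a₀, a₁, a₂, a₃] : Fin 4 → Fin (6 + 6) → Bool) i j))), by linarith⟩
  -- the ENGINE on the hyperplane and the pairing
  have hE := fl1_flat_l1 V P xP h0 hadd hS σ (fun x _ => hσval x) H3σ H4σ
  set A : (Fin (6 + 6) → Bool) → ℝ := fun x => if x ∈ P then (σ x : ℝ) else 0 with hA
  have hl1 : ∑ y, |W A y| ≤ 8192 := by
    by_contra hgt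
    push Not at hgt
    have hsq : (8192 : ℝ) ^ 2 < (∑ y, |W A y|) ^ 2 := pow_lt_pow_left₀ hgt (by norm_num) two_ne_zero
    norm_num at hE hsq
    linarith
  have hAW : ∑ x, A x * W (fun y => signOf (g y)) x = 32 * ((∑ x ∈ P, σ x * u' x : ℤ) : ℝ) := by
    have e1 : ∀ x, A x * W (fun y => signOf (g y)) x = if x ∈ P then (((32 * (σ x * u' x) : ℤ)) : ℝ) else 0 := by
      intro x
      simp only [A]
      split_ifs with hx
      · rw [hu' x]; push_cast; ring
      · rw [zero_mul]
    rw [sum_congr rfl fun x _ => e1 x, sum_ite_mem, univ_inter]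
    push_cast
    rw [mul_sum]
  have hσu : (∑ x ∈ P, σ x * u' x : ℤ) ≤ 256 := by
    have h1 : ∑ y, signOf (g y) * W A y ≤ 8192 := (fl1_pairing_le_l1 g (W A)).trans hl1
    rw [fl1_pairing g A, hAW] at h1
    have h2 : ((∑ x ∈ P, σ x * u' x : ℤ) : ℝ) ≤ 256 := by linarith
    exact_mod_cast h2
  -- integer bookkeeping: `4 Σ_x u's = 32768 − B ≥ 30496`, `u's = 2` off `P` (2048 points), so `Σ_P u's ≥ 3528`
  have hpar : ∑ x, u' x ^ 2 = 16384 := by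
    have h := zms_sum_u_sq 2 g u (fun x => (hu x).trans (by norm_num))
    have e4 : ∑ x, ((u x : ℝ)) ^ 2 = 4 * ∑ x, ((u' x : ℝ)) ^ 2 := by
      rw [mul_sum]; exact sum_congr rfl fun x _ => by simp only [u]; push_cast; ring
    rw [e4] at h
    norm_num at h
    have h' : ∑ x, ((u' x : ℝ)) ^ 2 = 16384 := by linarith
    exact_mod_cast h'
  have hs1 : ∀ x, sZ (f x) ^ 2 = 1 := fun x => by rcases tp_sZ_cases (f x) with h | h <;> rw [h] <;> norm_num
  have hus : 4 * ∑ x, u' x * sZ (f x) = 32768 - ∑ x, e x ^ 2 := by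
    have e1 : ∀ x, e x ^ 2 = u' x ^ 2 - 4 * (u' x * sZ (f x)) + 4 := fun x => by
      have he : e x = u' x - 2 * sZ (f x) := rfl
      rw [he]; linear_combination (4 : ℤ) * hs1 x
    rw [sum_congr rfl fun x _ => e1 x, sum_add_distrib, sum_sub_distrib, hpar, ← mul_sum, sum_const, card_univ, Fintype.card_fun,
      Fintype.card_bool, Fintype.card_fin]
    norm_num
    ring
  have hsplit2 : ∑ x, u' x * sZ (f x) = ∑ x ∈ P, u' x * sZ (f x) + ∑ x ∈ univ.filter (fun x => x ∉ P), u' x * sZ (f x) := by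
    rw [← sum_filter_add_sum_filter_not univ (fun x => x ∈ P)]
    congr 1
    exact sum_congr (by ext x; simp) fun _ _ => rfl
  have hoffus : ∑ x ∈ univ.filter (fun x => x ∉ P), u' x * sZ (f x) = 4096 := by
    have e1 : ∀ x ∈ univ.filter (fun x => x ∉ P), u' x * sZ (f x) = 2 := by
      intro x hx
      have h0 := hoff0 x (mem_filter.1 hx).2
      have hu1 : u' x = 2 * sZ (f x) := by simp only [e] at h0; linarith
      rw [hu1]; linear_combination (2 : ℤ) * hs1 x
    rw [sum_congr rfl e1, sum_const, nsmul_eq_mul]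
    have hc : #(univ.filter fun x : Fin (6 + 6) → Bool => x ∉ P) + #P = 4096 := by
      have h := Finset.card_filter_add_card_filter_not (s := (univ : Finset (Fin (6 + 6) → Bool))) (fun x => x ∉ P)
      rw [card_univ, Fintype.card_fun, Fintype.card_bool, Fintype.card_fin] at h
      have e2 : (univ.filter fun x : Fin (6 + 6) → Bool => ¬ x ∉ P) = P := by ext x; simp
      rw [e2] at h
      norm_num at h
      exact h
    have hc' : #(univ.filter fun x : Fin (6 + 6) → Bool => x ∉ P) = 2048 := by omega
    rw [hc']
    norm_num
  have hPus : (3528 : ℤ) ≤ ∑ x ∈ P, u' x * sZ (f x) := by linarith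
  -- pointwise on `P`: `σu' = 2u's − 3 + 8m(σ − 2s)` and `2·8m(σ − 2s) + (e² − 1) ≥ 0`
  have hpt : ∀ x ∈ P, σ x * u' x = 2 * (u' x * sZ (f x)) - 3 + 8 * (m x * (σ x - 2 * sZ (f x))) := by
    intro x hx
    have hd := hdec2 x hx
    have hu1 : u' x = 2 * sZ (f x) + σ x + 8 * m x := by simp only [e] at hd; linarith
    have hσ1 : σ x ^ 2 = 1 := by rcases hσval x with h | h <;> rw [h] <;> norm_num
    rw [hu1]; linear_combination hσ1 - 4 * hs1 x
  have hineq : ∀ x ∈ P, 0 ≤ 2 * (8 * (m x * (σ x - 2 * sZ (f x)))) + (e x ^ 2 - 1) := by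
    intro x hx
    have key := tw5_pt_ineq (σ x) (sZ (f x)) (m x) (hσval x) (tp_sZ_cases _)
    have hsq : e x ^ 2 = (σ x + 8 * m x) ^ 2 := congrArg (· ^ 2) (hdec2 x hx)
    linarith
  have hsum_pt : ∑ x ∈ P, σ x * u' x = 2 * ∑ x ∈ P, u' x * sZ (f x) - 3 * 2048 + ∑ x ∈ P, 8 * (m x * (σ x - 2 * sZ (f x))) := by
    rw [sum_congr rfl hpt, sum_add_distrib, sum_sub_distrib, ← mul_sum, sum_const, nsmul_eq_mul, hcardP]; push_cast; ring
  have hsum_ineq : 0 ≤ 2 * ∑ x ∈ P, 8 * (m x * (σ x - 2 * sZ (f x))) + ∑ x ∈ P, (e x ^ 2 - 1) := by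
    rw [mul_sum, ← sum_add_distrib]; exact sum_nonneg hineq
  linarith


end Summit.QuantumAdvantage.QuantumAdvantage.Theorems.CubicForrelation.NearExactIsExact

end
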